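import Summits.BirchSwinnertonDyer.BirchSwinnertonDyer.Theorems.ManinLocalTwoThreeGenerationHeckeCharacter
import HarnessLib

/-!
# Route `ManinLocalTwoThree`, crux C3 `ManinPrimeToThreeAtNine` (stmt-BirchSwinnertonDyer-22968): the kato-shift-three
# LEVER with its generation input taken from the line-facing homological E-es-25 instead of the leaf E-es-19
# (line prover p3; conditional on the quoted body of `EsG9Typed.RelativeIharaCokernelOfCurve 3 3 1`)

`katoShiftTwistManinThree_of_shiftStep` (tree, `KatoShiftThreeLawsEdges`) proves E-es-18 from the ES-step `hE` and the
generation leaf `ShiftClassGenerationThree` (E-es-19), but only ever applies E-es-19 to the GLOBALLY MINIMAL curve of a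
lattice-optimal datum at `ℓ₀ = 0`. `shiftClasses_of_relativeIharaCokernelOfCurve` (previous file) supplies exactly that
instance from the homological relative Ihara statement; this file re-runs the lever on it:
`katoShiftTwistManinThree_of_shiftStep_of_relativeIharaCokernelOfCurve (hE) (h) : KatoShiftTwistManinThree` — so in the
skeleton `Lines/kato_shift_three.lean` the stub `stub_shiftClass_generation` may be REPLACED by the body of
`RelativeIharaCokernelOfCurve 3 3 1` (es g10's line-facing E-es-25, MEMO-es §22) with the composition otherwise unchanged.
Nothing about BSD or Manin's conjecture is proved here.
-/

set_option autoImplicit false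
set_option linter.dupNamespace false

noncomputable section

open scoped MatrixGroups BigOperators

open CongruenceSubgroup Literature.NumberTheory.EllipticCurves.ModularForms

namespace Summit.BirchSwinnertonDyer.BirchSwinnertonDyer.Theorems.ManinLocalTwoThree

open scoped Classical ModularForm
open WeierstrassCurve Literature.NumberTheory.EllipticCurves Summit.BirchSwinnertonDyer.Rank1Residual.ManinAdditive

/-- **E-es-18 ⟸ (ES-step with a hole at `⟨3⟩`) ∧ the homological E-es-25 at `(3,3,1)`.** The tree's lever
`katoShiftTwistManinThree_of_shiftStep` with its second input `ShiftClassGenerationThree` replaced by the body of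
`EsG9Typed.RelativeIharaCokernelOfCurve 3 3 1` (VERBATIM as `h`), through `shiftClasses_of_relativeIharaCokernelOfCurve`
(the lever needs E-es-19 only for the datum's globally minimal curve, at `ℓ₀ = 0`). [folklore] -/
theorem katoShiftTwistManinThree_of_shiftStep_of_relativeIharaCokernelOfCurve
    (hE : ∀ (W : WeierstrassCurve ℚ) [W.IsElliptic] [W.IsGloballyMinimal] {N : ℕ} [NeZero N]
      (D : ModularParametrizationData W N),
      (∀ z ∈ D.L.lattice, ∃ w ∈ periodLattice D.f, z = D.c * w) → 3 ^ 2 ∣ N →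
      ¬ W.HasGoodReductionAtPrime 3 → ¬ W.HasMultiplicativeReductionAtPrime 3 →
      W.HasIrreducibleModPGaloisRep 3 → (3 : ℤ) ∣ D.c →
      ∀ ℓ : ℕ, AdmissiblePrime W N ℓ → ∀ a : ℕ, 0 < a → a < ℓ →
        ∃ n : ℤ, (shiftClass D.f ℓ a).im = 3 * n * (minusPeriod D.f / 2))
    (h : ∀ (W₀ : WeierstrassCurve ℚ) [W₀.IsElliptic] [W₀.IsGloballyMinimal], W₀.HasIrreducibleModPGaloisRep 3 →
      ∀ (N d L : ℕ) [NeZero N] [NeZero d] [NeZero L], (3 : ℕ).Prime → (3 : ℕ).Prime → 1 ≤ 1 → d = 3 ^ 1 →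
        L = d * N →
        ∀ 𝔫 : Ideal (HeckeRing0.primeTo N 2 (3 * N)), 𝔫.IsMaximal →
          (3 : HeckeRing0.primeTo N 2 (3 * N)) ∈ 𝔫 →
          (∀ (r : ℕ) (hr : r.Prime) (hrS : ¬ r ∣ 3 * N), ¬ r ∣ W₀.conductorNorm ℤ * 3 →
            HeckeRing0.primeTo.T N 2 (3 * N) hr hrS -
              (W₀.frobeniusTrace r : HeckeRing0.primeTo N 2 (3 * N)) ∈ 𝔫) →
          ∃ s : HeckeRing0.primeTo N 2 (3 * N), s ∉ 𝔫 ∧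
            ∀ x ∈ periodHomology N, ∃ z ∈ periodHomology L,
              (degeneracyMap0 N L d 2).dualMap z - (degeneracyMap0 N L 1 2).dualMap z =
                (s : HeckeRing0 N 2) • x) :
    KatoShiftTwistManinThree := by
  intro W _ _ N _ D hopt h9 hirr h3
  obtain ⟨hg, hm⟩ := additive_of_nine_dvd_level W D.f D.isNewformOf h9
  obtain ⟨m, hm3, hspan⟩ := shiftClasses_of_relativeIharaCokernelOfCurve h W hirr D.f D.isNewformOf h9 0
  have hpos : 0 < minusPeriod D.f :=
    IsNewform0.minusPeriod_pos_holds D.isNewformOf.1 D.isNewformOf.coeffField_eq_bot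
  refine functional_nonvanishing_gen D.f _ m hm3 hpos hspan ?_
  rintro t ⟨ℓ, ⟨-, hℓp, hℓN, hℓ12, hℓJ⟩, a, ha1, ha2, rfl⟩
  have hadm : AdmissiblePrime W N ℓ := by
    refine ⟨hℓp, hℓN, hℓ12, fun q hq hq2 => ?_⟩
    rw [hℓJ q hq hq2, epsSign]
  obtain ⟨n, hn⟩ := hE W D hopt h9 hg hm hirr h3 ℓ hadm a ha1 ha2
  exact ⟨n, hn⟩

end Summit.BirchSwinnertonDyer.BirchSwinnertonDyer.Theorems.ManinLocalTwoThree

end
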